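import Summits.ABC.IUTFork.Cor312ThetaLocalGeContentHull
import Summits.ABC.IUTFork.Cor312FactorMapLattice
import Summits.ABC.IUTFork.Cor312PilotKummerCompat
import Literature.IUT.LogVolume.TensorPacketShellHull
import HarnessLib

/-!
# [IUTchIII] Cor. 3.12, Step (xi-f): the q-region inside the Θ-hull of a PRESENTED packet — decided, for ANY typed setting,
# by the summand-wise CONTENT of the possible images and the OUTER RADII of the unit-log lattices (generic criterion)

PROOF-ONLY record file (D-0012; no definitions, no `Prop` facts, no instances) of the abc-iut cell (WAVE-5 prover seat
abc-iut-w5-d166, gen 6 — the G1-Θ / M-line lineage; D-0079 RESCUE sub-cell R-W «WINDOW Θ-SIDE INEQUALITY», lane U, row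
«W:M-LICENCE-EXACT», HOME/STATUS 2026-08-26T16:19:39Z; part 1 of 2 — part 2 `Cor312LicenceExactContentM` instantiates it at the
M-level setting of record `settingPrVolSharpM`). TAKES NO SIDE on [IUTchIII] Cor. 3.12 (S. Mochizuki, *Inter-universal Teichmüller
theory III*, kurims manuscript, Cor. 3.12 p. 173–174; Step (xi-f) p. 184) or on any author.

SETTING. A typed `Cor312.Setting` `P` (abc-iut-c312-6) over a situation `S`, a packet `(j, v_ℚ)` PRESENTED by a `p`-adic presentation
`Pr` (abc-iut-c312-5 `PadicPresentation`: summands `X_{v⃗} = ⊗_a K_{v⃗_a}`, field-factor decompositions `ψ_{v⃗}`), whose hull frame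
there is the pulled-back REAL frame (`hframe`, [IUTchIII] Rmk. 3.9.5 (i): hull-sets `λ·𝒪_L`) and whose q-pilot region there is the
pulled-back polydisc `λ_q·𝒪_L` of a centre `c_q` (`hq`; Dupuy–Hilado §3.9). This is the shape of EVERY sharp real setting in the
tree (abc-iut-c312-7 `settingPrVolSharp`, abc-iut-s2-p8 `settingPrVolSharpM`, abc-iut-c312-3 `settingDHVolSharp`).

WHAT IS PROVED (namespace `Summit.ABC.IUTFork.Cor312Vol`; `m : summands → ℤ`, `cout(v)` a norm-dominating element of
`log_p(𝒪^×_{K_v})` — abc-iut-c312-5's «T2-EXACT-CONTENT» binder convention `houtΛ`/`hdom`):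
* `norm_dEquiv_le_of_mem_zpow_smul_logPacket_of_isMaxOn`, `zpow_smul_purePacket_mem_and_norm` (packet algebra): the `ψ`-coordinates
  of `p^m·log_p(R_I^×)` are bounded by `‖p^m‖·∏_a ‖cout_a‖`, with EQUALITY at the pure tensor `p^m·⊗_a cout_a ∈ p^m·log_p(R_I^×)` (the
  `shellScalar`-free form of abc-iut-w4-d026's exact outer radius, `Cor312LicenceExactRadius` §1; abc-iut-w5-d082 `TensorPacketShellHull`);
* **`norm_centre_le_of_qRegion_subset_thetaHull`** (necessity): if the union of the possible images of the Θ-pilot lies summand-wise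
  in `p^{m(v⃗)}·log_p(R_{v⃗}^×)` (`hsub`), then `qRegion ⊆ ⁿ˒°𝒰_{j,v_ℚ}` forces `‖c_{q,(v⃗,J)}‖ ≤ ‖p^{m(v⃗)}‖·∏_a ‖cout(v⃗_a)‖` at every
  field factor: the pulled-back polydisc of exactly these radii is a hull-set containing every possible image, hence the hull;
* **`qRegion_subset_thetaHull_of_norm_centre_le`** (sufficiency): if every summand carries in the union of the possible images a
  vector of content EXACTLY `p^{m(v⃗)}` (`hwit`) and Ism is full on the summands (`hism` — every factorwise family of shell-preserving
  `ℚ_p`-linear automorphisms is realised by the indeterminacy group, Dupuy–Hilado §4.9), the same inequalities give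
  `qRegion ⊆ ⁿ˒°𝒰_{j,v_ℚ}`: every hull-set containing the possible images contains summand-wise the `ℤ_p`-span of the factorwise
  (Ind2)-orbit = `p^{m(v⃗)}·log_p(R_{v⃗}^×)` (abc-iut-s2-p9's mechanism of `Cor312ThetaLocalGeContentHull`, Literature
  `smul_logPacket_subset_closure_factorwiseOrbit`), whose radii are attained;
* **`qRegion_subset_thetaHull_iff_of_content`** — the two together; `pilotKummerCompatHull_const_iff` — for the q-PINNED
  region-former the hull-level clause S_H (`Cor312Vol.PilotKummerCompatHull`, the binder of the branch-C certificates) IS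
  `∀ j v_ℚ, qRegion ⊆ ⁿ˒°𝒰_{j,v_ℚ}`.

HONEST SCOPE: the per-packet inclusion is a STRONGER-THAN-PRINT set-level reading of Step (xi-f) (ADJUDICATION-SPEC §2 (G1′)); OUR
typed containers, OUR typed (Ind1)/(Ind2)/(Ind3); nothing here bears on the printed GLOBAL inequality or on the NUMBER-level
`Cor22.Cor312AtDatum`; no side taken. [cite: Mochizuki2012, IUTchIII Cor. 3.12 p. 173–174, Step (xi) p. 183–184; Thm. 3.11 (i)
(Ind1)(Ind2) p. 154; Rmk. 3.9.5 (i)(ii) p. 127; IUTchIV Prop. 1.2 (i) p. 10, Prop. 1.4 (i) p. 13] [cite: DupuyHilado2025, §3.9, §4.7,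
§4.9, §4.12] [cite: WeilBNT1967, Ch. II §2, Th. 1–2] [cite: ScholzeStix2018, §2.2 pp. 9–10] [claim: Mochizuki2012, status: disputed]
for every IUT sentence quoted. typed ≠ proved (these: proved); instantiated ≠ endorsed.
-/

noncomputable section

open Set Function NumberField IsDedekindDomain
open scoped Pointwise

/-! ## §1. Generic: the q-region inside the Θ-hull of a presented packet, by content and outer radii -/

namespace Summit.ABC.IUTFork.Cor312Vol

open Thm311 Cor312 Literature.IUT.LogThetaLattice Literature.IUT.LogVolume

section Packet

variable (p : ℕ) [hp : Fact p.Prime] {I : Type} [Fintype I] [DecidableEq I] [Nonempty I]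
  (k : I → Type) [∀ i, NontriviallyNormedField (k i)] [∀ i, NormedAlgebra ℚ_[p] (k i)]
  [∀ i, IsUltrametricDist (k i)] [∀ i, ProperSpace (k i)]

/-- **Outer radius of `p^m·log_p(R_I^×)` in the field-factor coordinates**: for a family `z_a` dominating the
`log_p(𝒪^×_a)` in norm, every `w ∈ p^m·log_p(R_I^×)` has `‖ψ_J(w)‖ ≤ ‖p^m‖·∏_a ‖z_a‖` (abc-iut-w5-d082
`logPacket_subset_purePacket_smul_normalizedPacket_of_isMaxOn`; `ψ((R_I)^∼)` is the unit polydisc; the `shellScalar`-free form of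
abc-iut-w4-d026's `norm_dEquiv_le_of_mem_smul_logShell_of_isMaxOn`). [cite: DupuyHilado2025, §4.12]
[cite: Mochizuki2012, IUTchIV Prop. 1.2 (i) p. 10] -/
theorem norm_dEquiv_le_of_mem_zpow_smul_logPacket_of_isMaxOn (m : ℤ) {z : Π i, k i}
    (hz : ∀ i, ∀ w ∈ logUnits (k i), ‖w‖ ≤ ‖z i‖) {w : PacketAlgebra p k}
    (hw : w ∈ ((p : ℚ_[p]) ^ m) • (logPacket p k : Set (PacketAlgebra p k))) (J : DIdx p k) :
    ‖dEquiv p k w J‖ ≤ ‖((p : ℚ_[p]) ^ m)‖ * ∏ i, ‖z i‖ := by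
  obtain ⟨w₂, hw₂, rfl⟩ := Set.mem_smul_set.mp hw
  obtain ⟨y, hy, rfl⟩ := Set.mem_smul_set.mp (logPacket_subset_purePacket_smul_normalizedPacket_of_isMaxOn p k hz hw₂)
  have hyJ : ‖dEquiv p k y J‖ ≤ 1 := by
    have hmem : dEquiv p k y ∈ dEquiv p k '' (normalizedPacket p k : Set (PacketAlgebra p k)) := ⟨y, hy, rfl⟩
    rw [image_normalizedPacket_eq_coe, coe_piUnitBallStructure, mem_polydisc] at hmem
    exact hmem J
  have hz' : ‖dEquiv p k (purePacket p k z) J‖ = ∏ i, ‖z i‖ := by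
    rw [psi_purePacket_apply, norm_prod]
    exact Finset.prod_congr rfl fun i _ => norm_factorEmb p k (DFac p k) (dEquiv p k) i J (z i)
  have hprod : 0 ≤ ∏ i, ‖z i‖ := Finset.prod_nonneg fun i _ => norm_nonneg _
  rw [map_smul, Pi.smul_apply, norm_smul, smul_eq_mul, map_mul, Pi.mul_apply, norm_mul, hz']
  calc ‖((p : ℚ_[p]) ^ m)‖ * ((∏ i, ‖z i‖) * ‖dEquiv p k y J‖)
      ≤ ‖((p : ℚ_[p]) ^ m)‖ * ((∏ i, ‖z i‖) * 1) := by gcongr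
    _ = ‖((p : ℚ_[p]) ^ m)‖ * ∏ i, ‖z i‖ := by ring

omit [Nonempty I] [∀ i, IsUltrametricDist (k i)] in
/-- **The outer radius is attained**: the pure tensor `p^m·⊗_a z_a` lies in `p^m·log_p(R_I^×)` when every `z_a ∈ log_p(𝒪^×_a)`,
and `‖ψ_J(p^m·⊗z_a)‖ = ‖p^m‖·∏_a ‖z_a‖` at every field factor `J`. [cite: DupuyHilado2025, §4.12]
[cite: Mochizuki2012, IUTchIV Prop. 1.4 (i) p. 13] -/
theorem zpow_smul_purePacket_mem_and_norm (m : ℤ) {z : Π i, k i} (hzmem : ∀ i, z i ∈ logUnits (k i)) :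
    ((p : ℚ_[p]) ^ m) • purePacket p k z ∈ ((p : ℚ_[p]) ^ m) • (logPacket p k : Set (PacketAlgebra p k)) ∧
      ∀ J : DIdx p k, ‖dEquiv p k (((p : ℚ_[p]) ^ m) • purePacket p k z) J‖ = ‖((p : ℚ_[p]) ^ m)‖ * ∏ i, ‖z i‖ := by
  refine ⟨Set.smul_mem_smul_set (purePacket_mem_logPacket_of_mem p k hzmem), fun J => ?_⟩
  rw [map_smul, Pi.smul_apply, norm_smul, psi_purePacket_apply, norm_prod]
  exact congrArg _ (Finset.prod_congr rfl fun i _ => norm_factorEmb p k (DFac p k) (dEquiv p k) i J (z i))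

end Packet

section Setting

open PadicPresentation

variable {T : ThetaIndex} {S : Situation T} {P : Cor312.Setting S} {vQ : T.VQ} {p : ℕ} [hp : Fact p.Prime]
  (Pr : PadicPresentation S.L vQ p)

/-- **Necessity.** Let the hull frame of `P` at `(j, v_ℚ)` be the pulled-back real frame of `Pr` (`hframe`) and the q-region there
the pulled-back polydisc `λ_q·𝒪_L` of a centre `c_q` (`hq`). If the union of the possible images of the Θ-pilot lies summand-wise in
`p^{m(v⃗)}·log_p(R_{v⃗}^×)` (`hsub`), then `qRegion ⊆ ⁿ˒°𝒰_{j,v_ℚ}` forces, at every summand `v⃗` and field factor `J`,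
`‖c_{q,(v⃗,J)}‖ ≤ ‖p^{m(v⃗)}‖·∏_a ‖cout(v⃗_a)‖` for any family `cout` dominating the `log_p(𝒪^×)` in norm: the pulled-back polydisc
of exactly these radii is a hull-set containing every possible image, hence `ⁿ˒°𝒰`, hence the q-centre.
[cite: Mochizuki2012, IUTchIII Rmk. 3.9.5 (i)(ii) p. 127; IUTchIV Prop. 1.2 (i) p. 10] [cite: DupuyHilado2025, §4.12] -/
theorem norm_centre_le_of_qRegion_subset_thetaHull (j : T.Label) [Fintype (Pr.factorIdx j)]
    (hframe : P.frame j vQ = HullFrame.ofComparison (Pr.factorField j) (fun x => Pr.factorMap j x))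
    (cq : ∀ s : Pr.factorIdx j, Pr.factorField j s)
    (hq : P.qRegion j vQ = (fun x => Pr.factorMap j x) ⁻¹' hullSet (Pr.factorField j) cq)
    (m : (T.Caps j → T.Fibre vQ) → ℤ)
    (hsub : ⋃₀ P.possibleImages j vQ ⊆ Pr.comparison j ⁻¹' Set.pi univ
      fun e => ((p : ℚ_[p]) ^ m e) • (logPacket p (Pr.kk e) : Set (Pr.X e)))
    (cout : ∀ v : T.Fibre vQ, Pr.k v) (hdom : ∀ v, ∀ z ∈ logUnits (Pr.k v), ‖z‖ ≤ ‖cout v‖)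
    (h : P.qRegion j vQ ⊆ P.thetaHull j vQ) (e : T.Caps j → T.Fibre vQ) (J : DIdx p (Pr.kk e)) :
    ‖cq ⟨e, J⟩‖ ≤ ‖((p : ℚ_[p]) ^ m e)‖ * ∏ a, ‖cout (e a)‖ := by
  classical
  haveI : Nonempty (T.Caps j) := ⟨0⟩
  -- the hull-set of radii `‖p^{m(v⃗)}‖·∏ρ_out`: centre `ψ_{v⃗}(p^{m(v⃗)}·⊗ cout(v⃗_a))`
  have hz0 : ∀ (e' : T.Caps j → T.Fibre vQ) (a : T.Caps j), cout (e' a) ≠ 0 :=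
    fun e' a => ne_zero_of_isMaxOn_logUnits p (Pr.kk e' a) (hdom (e' a))
  let c₀ : ∀ s : Pr.factorIdx j, Pr.factorField j s := fun s =>
    dEquiv p (Pr.kk s.1) (((p : ℚ_[p]) ^ m s.1) • purePacket p (Pr.kk s.1) fun a => cout (s.1 a)) s.2
  have hc₀norm : ∀ (e' : T.Caps j → T.Fibre vQ) (J' : DIdx p (Pr.kk e')),
      ‖c₀ ⟨e', J'⟩‖ = ‖((p : ℚ_[p]) ^ m e')‖ * ∏ a, ‖cout (e' a)‖ := fun e' J' => by
    show ‖dEquiv p (Pr.kk e') (((p : ℚ_[p]) ^ m e') • purePacket p (Pr.kk e') fun a => cout (e' a)) J'‖ = _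
    rw [map_smul, Pi.smul_apply, norm_smul, psi_purePacket_apply, norm_prod]
    exact congrArg _ (Finset.prod_congr rfl fun a _ => norm_factorEmb p (Pr.kk e') (DFac p (Pr.kk e')) _ a J' _)
  have hc₀ : ∀ s, c₀ s ≠ 0 := by
    rintro ⟨e', J'⟩
    rw [← norm_pos_iff, hc₀norm]
    refine mul_pos (norm_pos_iff.mpr (zpow_ne_zero _ (Nat.cast_ne_zero.mpr hp.out.ne_zero))) ?_
    exact Finset.prod_pos fun a _ => norm_pos_iff.mpr (hz0 e' a)
  -- it is a hull-set of the frame …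
  have hH₀ : (fun x => Pr.factorMap j x) ⁻¹' hullSet (Pr.factorField j) c₀ ∈ (P.frame j vQ).Hul := by
    rw [hframe]
    exact ⟨hullSet (Pr.factorField j) c₀, ⟨c₀, hc₀, rfl⟩, rfl⟩
  -- … containing every possible image
  have hUH₀ : ⋃₀ P.possibleImages j vQ ⊆ (fun x => Pr.factorMap j x) ⁻¹' hullSet (Pr.factorField j) c₀ := by
    intro x hx
    have hx' := hsub hx
    rw [Set.mem_preimage, Set.mem_univ_pi] at hx'
    rw [Set.mem_preimage, hullSet, mem_polydisc]
    rintro ⟨e', J'⟩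
    rw [hc₀norm]
    exact norm_dEquiv_le_of_mem_zpow_smul_logPacket_of_isMaxOn p (Pr.kk e') (m e') (fun a => hdom (e' a)) (hx' e') J'
  -- hence the hull, hence the q-region, hence the q-centre
  have hqH₀ : P.qRegion j vQ ⊆ (fun x => Pr.factorMap j x) ⁻¹' hullSet (Pr.factorField j) c₀ :=
    h.trans ((P.frame j vQ).hull_subset_of_mem hH₀ hUH₀)
  obtain ⟨xq, hxq⟩ := Pr.factorMap_surjective j cq
  have hxq' : ∀ s, Pr.factorMap j xq s = cq s := fun s => congrFun hxq s
  have hmem : xq ∈ P.qRegion j vQ := by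
    rw [hq, Set.mem_preimage, hullSet, mem_polydisc]
    intro s
    rw [hxq' s]
  have hle := hqH₀ hmem
  rw [Set.mem_preimage, hullSet, mem_polydisc] at hle
  have := hle ⟨e, J⟩
  rw [hxq' ⟨e, J⟩, hc₀norm] at this
  exact this

/-- **Sufficiency.** With `hframe`, `hq` as above: if every summand `v⃗` carries, in the union of the possible images, a vector of
content EXACTLY `p^{m(v⃗)}` (`hwit`), every factorwise family of shell-preserving `ℚ_p`-linear automorphisms is realised on `v⃗`
by an element of the indeterminacy group (`hism`), and `‖c_{q,(v⃗,J)}‖ ≤ ‖p^{m(v⃗)}‖·∏_a ‖cout(v⃗_a)‖` for elements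
`cout(v) ∈ log_p(𝒪^×_{K_v})`, then `qRegion ⊆ ⁿ˒°𝒰_{j,v_ℚ}`: a hull-set `e⁻¹(Π_{v⃗} ψ_{v⃗}⁻¹(λ_{v⃗}·𝒪))` containing the possible
images contains summand-wise the `ℤ_p`-span of the factorwise (Ind2)-orbit of the exact-content vector, i.e.
`p^{m(v⃗)}·log_p(R_{v⃗}^×)` (abc-iut-s2-p9's mechanism, Literature `smul_logPacket_subset_closure_factorwiseOrbit`), in particular
`p^{m(v⃗)}·⊗cout(v⃗_a)`, so its radii dominate the q-radii. [cite: Mochizuki2012, IUTchIII Thm. 3.11 (i) (Ind2) p. 154; IUTchIII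
Rmk. 3.9.5 (ii) p. 127] [cite: DupuyHilado2025, §4.9, §4.12] [cite: WeilBNT1967, Ch. II §2, Th. 1] -/
theorem qRegion_subset_thetaHull_of_norm_centre_le (j : T.Label) [Fintype (Pr.factorIdx j)]
    (hframe : P.frame j vQ = HullFrame.ofComparison (Pr.factorField j) (fun x => Pr.factorMap j x))
    (cq : ∀ s : Pr.factorIdx j, Pr.factorField j s)
    (hq : P.qRegion j vQ = (fun x => Pr.factorMap j x) ⁻¹' hullSet (Pr.factorField j) cq)
    (m : (T.Caps j → T.Fibre vQ) → ℤ)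
    (hwit : ∀ e : T.Caps j → T.Fibre vQ, ∃ x ∈ ⋃₀ P.possibleImages j vQ,
      Pr.comparison j x e ∈ ((p : ℚ_[p]) ^ m e) • (logPacket p (Pr.kk e) : Set (Pr.X e)) ∧
      Pr.comparison j x e ∉ ((p : ℚ_[p]) ^ (m e + 1)) • (logPacket p (Pr.kk e) : Set (Pr.X e)))
    (hism : ∀ (e : T.Caps j → T.Fibre vQ) (g' : ∀ a, Pr.kk e a ≃ₗ[ℚ_[p]] Pr.kk e a),
      (∀ a, g' a '' logUnits (Pr.kk e a) = logUnits (Pr.kk e a)) →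
      ∃ Φ ∈ Cor312.Setting.indGroup S, ∀ x, Pr.comparison j (Φ j vQ x) e =
        (PiTensorProduct.congr g' : Pr.X e ≃ₗ[ℚ_[p]] Pr.X e) (Pr.comparison j x e))
    (cout : ∀ v : T.Fibre vQ, Pr.k v) (houtΛ : ∀ v, cout v ∈ logUnits (Pr.k v))
    (hle : ∀ (e : T.Caps j → T.Fibre vQ) (J : DIdx p (Pr.kk e)), ‖cq ⟨e, J⟩‖ ≤ ‖((p : ℚ_[p]) ^ m e)‖ * ∏ a, ‖cout (e a)‖) :
    P.qRegion j vQ ⊆ P.thetaHull j vQ := by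
  classical
  haveI : Nonempty (T.Caps j) := ⟨0⟩
  intro y hy
  show y ∈ (P.frame j vQ).hull (⋃₀ P.possibleImages j vQ)
  by_cases hb : (P.frame j vQ).IsBounded (⋃₀ P.possibleImages j vQ)
  swap
  · rw [HullFrame.hull, if_neg hb]; exact Set.mem_univ _
  rw [HullFrame.hull, if_pos hb]
  refine Set.mem_sInter.mpr ?_
  rintro H ⟨hH, hUH⟩
  rw [hframe] at hH
  obtain ⟨H', hH', rfl⟩ := hH
  obtain ⟨c, hc, rfl⟩ := (HullFrame.mem_ofLocalFields_hul _).mp hH'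
  -- `y ∈ λ_q·𝒪_L`; it suffices that the radii of `H` dominate the q-radii
  rw [hq, Set.mem_preimage, hullSet, mem_polydisc] at hy
  rw [Set.mem_preimage, hullSet, mem_polydisc]
  rintro ⟨e, J⟩
  refine (hy ⟨e, J⟩).trans ((hle e J).trans ?_)
  -- the summand component `W_{v⃗}` of `H` contains `p^{m(v⃗)}·log_p(R_{v⃗}^×)` (abc-iut-s2-p9's mechanism)
  rw [Pr.factorMap_preimage_hullSet] at hUH
  have hUW : ∀ x ∈ ⋃₀ P.possibleImages j vQ,
      Pr.comparison j x e ∈ dEquiv p (Pr.kk e) ⁻¹' hullSet (DFac p (Pr.kk e)) fun i' => c ⟨e, i'⟩ := by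
    intro x hx
    have hx' := hUH hx
    rw [Set.mem_preimage, Set.mem_univ_pi] at hx'
    exact hx' e
  have hstab : ∀ g' : ∀ a, Pr.kk e a ≃ₗ[ℚ_[p]] Pr.kk e a, (∀ a, g' a '' logUnits (Pr.kk e a) = logUnits (Pr.kk e a)) →
      (PiTensorProduct.congr g' : Pr.X e ≃ₗ[ℚ_[p]] Pr.X e) ''
          ((fun x => Pr.comparison j x e) '' ⋃₀ P.possibleImages j vQ) ⊆
        (fun x => Pr.comparison j x e) '' ⋃₀ P.possibleImages j vQ := by
    intro g' hg'
    obtain ⟨Φ, hΦ, hΦe⟩ := hism e g' hg'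
    rintro _ ⟨_, ⟨x, hx, rfl⟩, rfl⟩
    obtain ⟨V, ⟨Φ₀, hΦ₀, rfl⟩, ⟨y', hy', rfl⟩⟩ := Set.mem_sUnion.mp hx
    refine ⟨Φ j vQ (Φ₀ j vQ y'), ?_, hΦe _⟩
    exact Set.mem_sUnion.mpr ⟨(Φ * Φ₀) j vQ '' P.thetaRegion3 j vQ,
      ⟨Φ * Φ₀, (Cor312.Setting.indGroup S).mul_mem hΦ hΦ₀, rfl⟩, ⟨y', hy', rfl⟩⟩
  obtain ⟨x, hxU, hxm, hxm1⟩ := hwit e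
  have hA := smul_logPacket_subset_closure_factorwiseOrbit p (Pr.kk e)
    (M := (fun x => Pr.comparison j x e) '' ⋃₀ P.possibleImages j vQ)
    (Set.mem_image_of_mem _ hxU) hxm (zpow_content p (Pr.kk e) hxm hxm1).2
  have hMW : packetHull p (Pr.kk e) ((fun x => Pr.comparison j x e) '' ⋃₀ P.possibleImages j vQ) ⊆
      dEquiv p (Pr.kk e) ⁻¹' hullSet (DFac p (Pr.kk e)) fun i' => c ⟨e, i'⟩ :=
    Pr.packetHull_subset_preimage_hullSet e _ (by rintro _ ⟨x', hx', rfl⟩; exact hUW x' hx')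
  have hΛW : ((p : ℚ_[p]) ^ m e) • (logPacket p (Pr.kk e) : Set (Pr.X e)) ⊆
      dEquiv p (Pr.kk e) ⁻¹' hullSet (DFac p (Pr.kk e)) fun i' => c ⟨e, i'⟩ := by
    refine hA.trans fun w hw => hMW ?_
    have hle' : AddSubgroup.closure (⋃ g' ∈ {g' : ∀ a, Pr.kk e a ≃ₗ[ℚ_[p]] Pr.kk e a |
          ∀ a, g' a '' logUnits (Pr.kk e a) = logUnits (Pr.kk e a)},
        (PiTensorProduct.congr g' : Pr.X e ≃ₗ[ℚ_[p]] Pr.X e) ''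
          ((fun x => Pr.comparison j x e) '' ⋃₀ P.possibleImages j vQ)) ≤
        (packetSpan p (Pr.kk e) ((fun x => Pr.comparison j x e) '' ⋃₀ P.possibleImages j vQ)).toAddSubgroup := by
      rw [AddSubgroup.closure_le]
      exact (Set.iUnion₂_subset fun g' hg' => hstab g' hg').trans (subset_packetHull p (Pr.kk e) _)
    exact hle' hw
  -- the outer radius is attained at `p^{m(v⃗)}·⊗cout(v⃗_a) ∈ p^{m(v⃗)}·log_p(R_{v⃗}^×) ⊆ W_{v⃗}`
  obtain ⟨hwmem, hwnorm⟩ := zpow_smul_purePacket_mem_and_norm p (Pr.kk e) (m e) (z := fun a => cout (e a))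
    (fun a => houtΛ (e a))
  have hwW := hΛW hwmem
  rw [Set.mem_preimage, hullSet, mem_polydisc] at hwW
  have := hwW J
  rw [hwnorm J] at this
  exact this

/-- **THE GENERIC CRITERION** (necessity + sufficiency): under `hframe`, `hq`, with `m` the summand-wise EXACT content of the union
of the possible images (`hsub` + `hwit`) and Ism full on the summands (`hism`), for any family `cout` of elements of LARGEST norm in
the `log_p(𝒪^×_{K_v})`:  `qRegion (j,v_ℚ) ⊆ ⁿ˒°𝒰_{j,v_ℚ}` ⟺ `∀ v⃗ J, ‖c_{q,(v⃗,J)}‖ ≤ ‖p^{m(v⃗)}‖·∏_a ‖cout(v⃗_a)‖`.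
[cite: Mochizuki2012, IUTchIII Cor. 3.12 Step (xi-f) p. 184; Thm. 3.11 (i) p. 154] [cite: DupuyHilado2025, §4.9, §4.12] -/
theorem qRegion_subset_thetaHull_iff_of_content (j : T.Label) [Fintype (Pr.factorIdx j)]
    (hframe : P.frame j vQ = HullFrame.ofComparison (Pr.factorField j) (fun x => Pr.factorMap j x))
    (cq : ∀ s : Pr.factorIdx j, Pr.factorField j s)
    (hq : P.qRegion j vQ = (fun x => Pr.factorMap j x) ⁻¹' hullSet (Pr.factorField j) cq)
    (m : (T.Caps j → T.Fibre vQ) → ℤ)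
    (hsub : ⋃₀ P.possibleImages j vQ ⊆ Pr.comparison j ⁻¹' Set.pi univ
      fun e => ((p : ℚ_[p]) ^ m e) • (logPacket p (Pr.kk e) : Set (Pr.X e)))
    (hwit : ∀ e : T.Caps j → T.Fibre vQ, ∃ x ∈ ⋃₀ P.possibleImages j vQ,
      Pr.comparison j x e ∈ ((p : ℚ_[p]) ^ m e) • (logPacket p (Pr.kk e) : Set (Pr.X e)) ∧
      Pr.comparison j x e ∉ ((p : ℚ_[p]) ^ (m e + 1)) • (logPacket p (Pr.kk e) : Set (Pr.X e)))
    (hism : ∀ (e : T.Caps j → T.Fibre vQ) (g' : ∀ a, Pr.kk e a ≃ₗ[ℚ_[p]] Pr.kk e a),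
      (∀ a, g' a '' logUnits (Pr.kk e a) = logUnits (Pr.kk e a)) →
      ∃ Φ ∈ Cor312.Setting.indGroup S, ∀ x, Pr.comparison j (Φ j vQ x) e =
        (PiTensorProduct.congr g' : Pr.X e ≃ₗ[ℚ_[p]] Pr.X e) (Pr.comparison j x e))
    (cout : ∀ v : T.Fibre vQ, Pr.k v) (houtΛ : ∀ v, cout v ∈ logUnits (Pr.k v))
    (hdom : ∀ v, ∀ z ∈ logUnits (Pr.k v), ‖z‖ ≤ ‖cout v‖) :
    P.qRegion j vQ ⊆ P.thetaHull j vQ ↔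
      ∀ (e : T.Caps j → T.Fibre vQ) (J : DIdx p (Pr.kk e)), ‖cq ⟨e, J⟩‖ ≤ ‖((p : ℚ_[p]) ^ m e)‖ * ∏ a, ‖cout (e a)‖ :=
  ⟨fun h e J => norm_centre_le_of_qRegion_subset_thetaHull Pr j hframe cq hq m hsub cout hdom h e J,
    fun h => qRegion_subset_thetaHull_of_norm_centre_le Pr j hframe cq hq m hwit hism cout houtΛ h⟩

end Setting

end Summit.ABC.IUTFork.Cor312Vol


/-- The hull-level clause `PilotKummerCompatHull` for the q-PINNED region-former `ρ := qRegion` (the reading of the branch-C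
certificates, q-pin by `rfl`) IS `∀ j v_ℚ, qRegion ⊆ ⁿ˒°𝒰_{j,v_ℚ}` — so `forall_qRegion_subset_thetaHull_settingPrVolSharpM_iff_radii`
decides the `hSHw` / `hNumOffBad_M` binders of the M-line certificates packet by packet. [claim: Mochizuki2012, status: disputed] -/
theorem Summit.ABC.IUTFork.Cor312Vol.pilotKummerCompatHull_const_iff {T : Summit.ABC.IUTFork.Thm311.ThetaIndex}
    (S : Summit.ABC.IUTFork.Thm311.LatticeSituation T) (P : Summit.ABC.IUTFork.Cor312.Setting S.toSituation)
    (qK : ∀ v : T.V, v ∈ T.Vbad → Set (S.L.StarPacket v)) :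
    Summit.ABC.IUTFork.Cor312Vol.PilotKummerCompatHull S P (fun _ => P.qRegion) qK ↔
      ∀ (j : T.Label) (vQ : T.VQ), P.qRegion j vQ ⊆ P.thetaHull j vQ :=
  Iff.rfl

end
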